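import Summits.SmoothPoincare4.SmoothPoincare4.Theorems.CylinderEntropyCylinderRungTwoShiftLemma
import Summits.SmoothPoincare4.SmoothPoincare4.Theorems.CylinderEntropyCylinderRungTwoCylKernelSlabBounds
import Summits.SmoothPoincare4.SmoothPoincare4.Theorems.CylinderEntropyCylinderRungTwoUnitLowerDensity
import Summits.SmoothPoincare4.SmoothPoincare4.Theorems.CylinderEntropyCylinderRungTwoAtomOfLiminfDensity
import Literature.Geometry.Riemannian.SphericalCylinderEntropyZonalSmooth
import HarnessLib

/-!
# Route `CylinderEntropy`, crux `CylinderRungTwo` (stmt-SmoothPoincare4-7631), line `killing-flux`: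
# unit lower density along GOOD TIMES of a cylinder flow
# (registered helper `helper_liminfDensityAlongGoodTimes`; lead c4, "relaxation up to multiplicity",
# worker A3')

Along a smooth mean curvature flow `IsCylinderMCF M F ν T` of closed embedded cross-sections of
`N = S⁴ × ℝ ⊂ ℝ⁶`, let `t k ≥ T + 1` be GOOD TIMES: the window dissipations
`D_k = ∫⁻_{[t_k - 1, t_k]} ∫⁻ ‖∂_r F‖² d((F r)^* μH⁴) dr` tend to `0`.  Then for all points
`y_k = F (t k) (x k)` of the slices `M_{t_k} = range (F (t k))` and every scale `τ ∈ (0, 1]` the typed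
slice-normalised Gaussian densities satisfy

  `1 ≤ liminf_k F̂_{y_k, τ}(M_{t_k})`.

Proof.  (1) Unit lower density at the EARLIER slice (`helper_unitLowerDensityAlongFlow`, landed):
`1 ≤ F̂_{y_k, τ}(M_{t_k - τ})`, since `y_k` is reached by the flow `τ` after `t_k - τ ≥ T`.
(2) The SHIFT LEMMA (`helper_shiftLemma`, landed) with the `C¹` test function `φ = K_{y_k, τ}`
(`contDiff_cylKernel`), whose value and derivative are bounded on the slab `N ∩ {|z₅| ≤ B}` containing
every slice `M_r`, `r ≥ T`, uniformly in the centre `y_k` of the same slab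
(`helper_cylKernelSlabBounds`; `B` from slab confinement `stub_slabConfinement` and compactness of `M`):
`|∫_{M_{t_k}} K_{y_k,τ} - ∫_{M_{t_k - τ}} K_{y_k,τ}| ≤ A₀ D'_k + A₁ √(τ · μH⁴(M_{t_k-τ}) · D'_k) ≤ ε_k`,
`ε_k = A₀ D_k + A₁ √(τ · μH⁴(M_T) · D_k) → 0` (the dissipation over `[t_k - τ, t_k] ⊆ [t_k - 1, t_k]`
is `D'_k ≤ D_k`, areas decrease by the budget `stub_dissipationBudget`).  (3) Both densities are
`vol⁻¹ · ofReal` of these set integrals (`cylDensity_eq_inv_mul_ofReal_setIntegral`; the integrals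
against `(F r)^* μH⁴` are set integrals over `range (F r)`, `MeasurableEmbedding.map_comap`), so
`1 ≤ F̂_{y_k,τ}(M_{t_k-τ}) ≤ F̂_{y_k,τ}(M_{t_k}) + vol⁻¹ ofReal ε_k` with the last term `→ 0` in
`ℝ≥0∞`, whence `liminf_k F̂_{y_k,τ}(M_{t_k}) ≥ liminf_k (1 - vol⁻¹ ofReal ε_k) = 1`.

Everything here is PROVED (no `sorry`, no definitions, no named facts).

References: K. A. Brakke, *The motion of a surface by its mean curvature* (1978), §3 (mass
continuity and densities along the flow); R. S. Hamilton, Comm. Anal. Geom. 1 (1993) 127–137, Thm. 4.1.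
-/

-- the prescribed namespace `Summit.SmoothPoincare4.SmoothPoincare4.…` repeats `SmoothPoincare4`
set_option linter.dupNamespace false

noncomputable section

open Bundle Set Function Filter MeasureTheory Module
open scoped Manifold ContDiff Topology RealInnerProductSpace BigOperators ENNReal NNReal

namespace Summit.SmoothPoincare4.SmoothPoincare4.Cruxes.CylinderRungTwo.KillingFlux

open Literature.Geometry.Riemannian Literature.Geometry.Riemannian.SphericalCylinderConformal
open Literature.Geometry.Riemannian.SphericalCylinderEntropy (cylKernel cylDensity contDiff_cylKernel
  hausdorffMeasure_sphere_four_pos hausdorffMeasure_sphere_four_lt_top)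
open AtomOfLiminfDensity

namespace LiminfDensityAlongGoodTimes

/-! ## Elementary pieces -/

/-- The real error `A₀ d + A₁ √(τ a d)` is monotone in the dissipation `d ≥ 0` and the area `a ≥ 0`
for `A₀, A₁, τ ≥ 0`. [folklore] -/
theorem error_mono {A₀ A₁ τ a a' d d' : ℝ} (hA₀ : 0 ≤ A₀) (hA₁ : 0 ≤ A₁) (hτ : 0 ≤ τ)
    (ha' : 0 ≤ a') (hd : 0 ≤ d) (haa' : a ≤ a') (hdd' : d ≤ d') :
    A₀ * d + A₁ * Real.sqrt (τ * a * d) ≤ A₀ * d' + A₁ * Real.sqrt (τ * a' * d') := by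
  gcongr

/-- The real error `A₀ d + A₁ √(c d)` tends to `0` as `d → 0`. [folklore] -/
theorem tendsto_error {A₀ A₁ c : ℝ} {d : ℕ → ℝ} (hd : Tendsto d atTop (𝓝 0)) :
    Tendsto (fun k => A₀ * d k + A₁ * Real.sqrt (c * d k)) atTop (𝓝 0) := by
  have h := (hd.const_mul A₀).add (((hd.const_mul c).sqrt).const_mul A₁)
  simpa using h

/-- `ℝ≥0∞` bookkeeping of a `liminf`: if `1 ≤ a k + b k` for all `k` and `b k → 0`, then
`1 ≤ liminf a`. [folklore] -/
theorem one_le_liminf_of_add {a b : ℕ → ℝ≥0∞} (hab : ∀ k, 1 ≤ a k + b k)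
    (hb : Tendsto b atTop (𝓝 0)) : 1 ≤ liminf a atTop := by
  have hsub : ∀ k, 1 - b k ≤ a k := fun k => tsub_le_iff_right.2 (hab k)
  have hlim : Tendsto (fun k => 1 - b k) atTop (𝓝 1) := by
    have h := ENNReal.Tendsto.sub (tendsto_const_nhds : Tendsto (fun _ : ℕ => (1 : ℝ≥0∞)) atTop (𝓝 1))
      hb (Or.inl ENNReal.one_ne_top)
    rwa [tsub_zero] at h
  calc (1 : ℝ≥0∞) = liminf (fun k => 1 - b k) atTop := hlim.liminf_eq.symm
    _ ≤ liminf a atTop := liminf_le_liminf (Eventually.of_forall hsub)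

/-- From `|I - I'| ≤ e ≤ ε`: `I' ≤ I + ε`. [folklore] -/
theorem le_add_of_abs_sub_le {I I' e ε : ℝ} (h : |I - I'| ≤ e) (he : e ≤ ε) : I' ≤ I + ε := by
  linarith [neg_abs_le (I - I')]

/-! ## Flow pieces -/

section Flow

variable {M : Type} [TopologicalSpace M] [ChartedSpace (EuclideanSpace ℝ (Fin 4)) M]
  [IsManifold (𝓡 4) ∞ M] {F ν : ℝ → M → EuclideanSpace ℝ (Fin 6)} {T : ℝ}

/-- **Uniform height bound along a cylinder flow**: the heights `|(F r x)₅|`, `r ≥ T`, `x ∈ M`, are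
bounded by the bound of the continuous initial height on the compact `M` (slab confinement
`stub_slabConfinement`). [folklore] -/
theorem exists_abs_apply_five_le [T2Space M] [SecondCountableTopology M] [CompactSpace M]
    (h : IsCylinderMCF M F ν T) : ∃ B : ℝ, ∀ r, T ≤ r → ∀ x : M, |F r x 5| ≤ B := by
  have hc : Continuous fun y : M => F T y 5 :=
    (EuclideanSpace.proj 5 : EuclideanSpace ℝ (Fin 6) →L[ℝ] ℝ).continuous.comp
      (h.isSpacelikeImmersion T le_rfl).contMDiff.continuous
  obtain ⟨C, hC⟩ := isCompact_univ.exists_bound_of_continuousOn hc.continuousOn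
  refine ⟨C, fun r hr x => ?_⟩
  obtain ⟨y, y', hy, hy'⟩ := stub_slabConfinement M F ν T h r hr x
  have h1 := hC y (mem_univ y)
  have h2 := hC y' (mem_univ y')
  rw [Real.norm_eq_abs, abs_le] at h1 h2
  rw [abs_le]
  exact ⟨h1.1.trans hy, hy'.trans h2.2⟩

/-- **Integrals against `(F s)^* μH⁴` are set integrals over the slice**: for `s ≥ T` and
`ψ : ℝ⁶ → ℝ`, `∫_M ψ(F s x) d((F s)^* μH⁴)(x) = ∫_{range (F s)} ψ dμH⁴` (`F s` is a closed measurable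
embedding, `MeasurableEmbedding.map_comap`). [folklore] -/
theorem integral_comp_comap_eq [CompactSpace M] [MeasurableSpace M] [BorelSpace M]
    (h : IsCylinderMCF M F ν T) {s : ℝ} (hs : T ≤ s) (ψ : EuclideanSpace ℝ (Fin 6) → ℝ) :
    ∫ x, ψ (F s x) ∂(Measure.comap (F s) (μH[4] : Measure (EuclideanSpace ℝ (Fin 6)))) =
      ∫ z in range (F s), ψ z ∂(μH[4] : Measure (EuclideanSpace ℝ (Fin 6))) := by
  have hme : MeasurableEmbedding (F s) :=
    ((h.isSpacelikeImmersion s hs).contMDiff.continuous.isClosedEmbedding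
      (h.injective hs)).measurableEmbedding
  rw [← hme.map_comap, hme.integral_map]

/-- The slices `range (F s)`, `s ≥ T`, are measurable subsets of `N` of finite area. [folklore] -/
theorem range_measurable_mem_finite [CompactSpace M] (h : IsCylinderMCF M F ν T) {s : ℝ}
    (hs : T ≤ s) :
    MeasurableSet (range (F s)) ∧ (∀ z ∈ range (F s), ∑ i : Fin 5, z (Fin.castSucc i) ^ 2 = 1) ∧
      (μH[4] : Measure (EuclideanSpace ℝ (Fin 6))) (range (F s)) ≠ ⊤ := by
  refine ⟨(isCompact_range (h.isSmoothEmbedding s hs).contMDiff.continuous).isClosed.measurableSet,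
    ?_, (hausdorffMeasure_range_lt_top_six M (h.isSmoothEmbedding s hs)).ne⟩
  rintro _ ⟨w, rfl⟩
  exact h.mem_cyl s hs w

end Flow

end LiminfDensityAlongGoodTimes

open LiminfDensityAlongGoodTimes

/-- **Registered helper `helper_liminfDensityAlongGoodTimes` of line `killing-flux` (lead c4,
relaxation up to multiplicity, A3').**  Along a smooth cylinder flow `IsCylinderMCF M F ν T`, if
`t k ≥ T + 1` are good times (the window dissipations `∫⁻_{[t_k-1,t_k]} ∫⁻ ‖∂_r F‖² → 0`), then for
all `x k ∈ M` and every scale `τ ∈ (0, 1]` the typed densities of `M_{t_k}` at its own points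
`y_k = F (t k) (x k)` satisfy `1 ≤ liminf_k F̂_{y_k,τ}(M_{t_k})`: unit lower density of the earlier
slice `M_{t_k - τ}` at `y_k` (`helper_unitLowerDensityAlongFlow`) and the shift lemma
(`helper_shiftLemma`) with the test function `K_{y_k,τ}`, bounded with its derivative on the slab
containing the flow (`helper_cylKernelSlabBounds`, `stub_slabConfinement`), whose error is controlled by
the vanishing window dissipation. [cite: Brakke1978, §3] -/
theorem helper_liminfDensityAlongGoodTimes : ∀ (M : Type) [TopologicalSpace M] [T2Space M] [SecondCountableTopology M] [ChartedSpace (EuclideanSpace ℝ (Fin 4)) M] [IsManifold (𝓡 4) ∞ M] [CompactSpace M] [MeasurableSpace M] [BorelSpace M] (F : ℝ → M → EuclideanSpace ℝ (Fin 6)) (ν : ℝ → M → EuclideanSpace ℝ (Fin 6)) (T : ℝ), IsCylinderMCF M F ν T → ∀ (t : ℕ → ℝ), (∀ k, T + 1 ≤ t k) → Filter.Tendsto (fun k => ∫⁻ r in Set.Icc (t k - 1) (t k), ∫⁻ x, ENNReal.ofReal (‖deriv (fun s => F s x) r‖ ^ 2) ∂(Measure.comap (F r) (μH[4] : Measure (EuclideanSpace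 ℝ (Fin 6))))) Filter.atTop (𝓝 0) → ∀ (x : ℕ → M) (τ : ℝ), 0 < τ → τ ≤ 1 → 1 ≤ Filter.liminf (fun k => Literature.Geometry.Riemannian.SphericalCylinderEntropy.cylDensity (Set.range (F (t k))) (F (t k) (x k)) τ) Filter.atTop := by
  intro M _ _ _ _ _ _ _ _ F ν T hF t ht hD x τ hτ hτ1
  -- Step 0: times, the normalising constant, areas
  have hTk : ∀ k, T ≤ t k - τ := fun k => by linarith [ht k]
  have hTk' : ∀ k, T ≤ t k := fun k => by linarith [ht k]
  have hTk1 : ∀ k, T ≤ t k - 1 := fun k => by linarith [ht k]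
  have hvinv : (μH[4] (Metric.sphere (0 : EuclideanSpace ℝ (Fin 5)) 1))⁻¹ ≠ ⊤ :=
    ENNReal.inv_ne_top.2 hausdorffMeasure_sphere_four_pos.ne'
  have hareaT : μH[4] (range (F T)) < ⊤ :=
    hausdorffMeasure_range_lt_top_six M (hF.isSmoothEmbedding T le_rfl)
  have harea : ∀ s, T ≤ s → μH[4] (range (F s)) ≤ μH[4] (range (F T)) := fun s hs =>
    le_add_self.trans (hF.dissipationBudget hs)
  -- Step 1: unit lower density of the earlier slice `M_{t k - τ}` at `y_k = F (t k) (x k)`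
  have h1 : ∀ k, 1 ≤ cylDensity (range (F (t k - τ))) (F (t k) (x k)) τ := fun k => by
    have h := helper_unitLowerDensityAlongFlow M F ν T hF (t k - τ) τ (hTk k) hτ (x k)
    rwa [sub_add_cancel] at h
  -- Step 2: the uniform height bound and the kernel bounds on the slab
  obtain ⟨B, hB⟩ := exists_abs_apply_five_le hF
  obtain ⟨A₀, A₁, hA₀, hA₁, hA⟩ := helper_cylKernelSlabBounds B τ hτ
  -- the dissipations over `[t k - 1, t k]` and `[t k - τ, t k]`, the real error
  set D : ℕ → ℝ≥0∞ := fun k => ∫⁻ r in Icc (t k - 1) (t k), ∫⁻ x, ENNReal.ofReal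
    (‖deriv (fun s => F s x) r‖ ^ 2) ∂(Measure.comap (F r) (μH[4] : Measure (EuclideanSpace ℝ (Fin 6))))
    with hDdef
  have hD'le : ∀ k, (∫⁻ r in Icc (t k - τ) (t k), ∫⁻ x, ENNReal.ofReal (‖deriv (fun s => F s x) r‖ ^ 2)
      ∂(Measure.comap (F r) (μH[4] : Measure (EuclideanSpace ℝ (Fin 6))))) ≤ D k := fun k =>
    lintegral_mono_set (Icc_subset_Icc (by linarith) le_rfl)
  have hDfin : ∀ k, D k ≠ ⊤ := fun k => by
    have h := (hF.of_le (hTk1 k)).dissipationBudget (show t k - 1 ≤ t k by linarith)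
    exact ne_top_of_le_ne_top hareaT.ne (le_self_add.trans (h.trans (harea _ (hTk1 k))))
  set ε : ℕ → ℝ := fun k => A₀ * (D k).toReal +
    A₁ * Real.sqrt (τ * (μH[4] (range (F T))).toReal * (D k).toReal) with hεdef
  have hεt : Tendsto ε atTop (𝓝 0) := by
    have hDr : Tendsto (fun k => (D k).toReal) atTop (𝓝 0) := by
      have h := (ENNReal.tendsto_toReal ENNReal.zero_ne_top).comp hD
      rwa [ENNReal.toReal_zero] at h
    exact tendsto_error hDr
  -- Step 3: the shift estimate, `F̂_{y_k,τ}(M_{t_k-τ}) ≤ F̂_{y_k,τ}(M_{t_k}) + vol⁻¹ ofReal ε_k`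
  have hkey : ∀ k, cylDensity (range (F (t k - τ))) (F (t k) (x k)) τ ≤
      cylDensity (range (F (t k))) (F (t k) (x k)) τ +
        (μH[4] (Metric.sphere (0 : EuclideanSpace ℝ (Fin 5)) 1))⁻¹ * ENNReal.ofReal (ε k) := by
    intro k
    have hyN : ∑ i : Fin 5, F (t k) (x k) (Fin.castSucc i) ^ 2 = 1 := hF.mem_cyl (t k) (hTk' k) (x k)
    have hyB : |F (t k) (x k) 5| ≤ B := hB (t k) (hTk' k) (x k)
    -- the shift lemma with `φ = K_{y_k, τ}` on `[t k - τ, t k]`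
    have hshift := helper_shiftLemma M F ν T hF (cylKernel (F (t k) (x k)) τ)
      ((contDiff_cylKernel (F (t k) (x k)) hτ).of_le (by norm_cast)) A₀ A₁ (t k - τ) (t k) (hTk k)
      (by linarith) (fun r hr z => hA (F (t k) (x k)) (F r z) hyN hyB
        (hF.mem_cyl r ((hTk k).trans hr.1) z) (hB r ((hTk k).trans hr.1) z))
    rw [integral_comp_comap_eq hF (hTk' k), integral_comp_comap_eq hF (hTk k)] at hshift
    -- the error is at most `ε k`
    have hbound : A₀ * (∫⁻ r in Icc (t k - τ) (t k), ∫⁻ x, ENNReal.ofReal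
        (‖deriv (fun s => F s x) r‖ ^ 2) ∂(Measure.comap (F r)
          (μH[4] : Measure (EuclideanSpace ℝ (Fin 6))))).toReal +
        A₁ * Real.sqrt ((t k - (t k - τ)) * (μH[4] (range (F (t k - τ)))).toReal *
          (∫⁻ r in Icc (t k - τ) (t k), ∫⁻ x, ENNReal.ofReal (‖deriv (fun s => F s x) r‖ ^ 2)
            ∂(Measure.comap (F r) (μH[4] : Measure (EuclideanSpace ℝ (Fin 6))))).toReal) ≤ ε k := by
      rw [show t k - (t k - τ) = τ by ring]
      exact error_mono hA₀ hA₁ hτ.le ENNReal.toReal_nonneg ENNReal.toReal_nonneg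
        (ENNReal.toReal_mono hareaT.ne (harea _ (hTk k))) (ENNReal.toReal_mono (hDfin k) (hD'le k))
    have hI := le_add_of_abs_sub_le hshift hbound
    -- the densities as real set integrals
    obtain ⟨hm, hN, hfin⟩ := range_measurable_mem_finite hF (hTk k)
    obtain ⟨hm', hN', hfin'⟩ := range_measurable_mem_finite hF (hTk' k)
    rw [cylDensity_eq_inv_mul_ofReal_setIntegral hm hN hfin hyN hτ,
      cylDensity_eq_inv_mul_ofReal_setIntegral hm' hN' hfin' hyN hτ, ← mul_add]
    gcongr
    exact (ENNReal.ofReal_le_ofReal hI).trans ENNReal.ofReal_add_le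
  -- Step 4: `vol⁻¹ ofReal ε_k → 0`, so `liminf ≥ 1`
  have hb : Tendsto (fun k => (μH[4] (Metric.sphere (0 : EuclideanSpace ℝ (Fin 5)) 1))⁻¹ *
      ENNReal.ofReal (ε k)) atTop (𝓝 0) := by
    have h := ENNReal.Tendsto.const_mul (ENNReal.tendsto_ofReal hεt) (Or.inr hvinv)
    rwa [ENNReal.ofReal_zero, mul_zero] at h
  exact one_le_liminf_of_add (fun k => (h1 k).trans (hkey k)) hb

end Summit.SmoothPoincare4.SmoothPoincare4.Cruxes.CylinderRungTwo.KillingFlux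

end
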